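import Summits.MatrixMultiplication.MatrixMultiplication.Theorems.EdgePencilPairing
import Summits.MatrixMultiplication.MatrixMultiplication.Theorems.EdgePencilSixthDuality
import Summits.MatrixMultiplication.MatrixMultiplication.Theorems.EdgePencilExcess

/-!
# The un-pairing floor `N²·e ≤ R₄(X_N^{(e,d)})`, and: an UN-PAIRED rung certificate refutes `ω = 2`

Support kernel (3/3) for `stmt-MatrixMultiplication-26697` (`TetraExcessZero`), rung side
`stub_sixRungPos` of `Cruxes/TetraExcessZero/Lines/rung_and_chord`; lineage `decomp-mm-lens-6`
generation 31 (NODE-g31 §2); object in `EdgePencilHalfTetra`, pairing in `EdgePencilPairing`.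
NODE-g26 §2 I-R1 `flattening_floor`, now proved, plus its exponent reading. No item is added or
changed.

THE UN-PAIRING FLOOR (§4). The party-`0` flattening of `X = X_N^{(e,d)}` has rank `N²·e` (its `N²e`
one-leg slices are linearly independent: `card_le_tensorRankD_of_linearIndependent₀`, the one-leg
version of `TetrahedronTensorCore.card_le_tensorRankD_of_linearIndependent`), so
`N·N·e ≤ R₄(X_N^{(e,d)})` (`sq_mul_le_tensorRankD_halfTetra`): evaluated SEPARATELY, each half of
the pair `(X, σX)` is charged the full pendant.

THE BY-NAME COROLLARY (§5). If the half-tensor family `X_{m²}^{(⌈m^δ⌉, m)}` is evaluated with an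
exponent `a` (`R₄ ≤ C·m^a`, `m ≥ 1`), then `4 + δ ≤ a` (`four_add_le_of_halfBound`); hence an
UN-PAIRED certificate of the rung — `a ≤ ψ = ω(2,1,2)`, which through the pairing
`R₄(W_{m²}^{(⌈m^δ⌉²)}) ≤ R₄(X)²` (`EdgePencilPairing.tensorRankD_sixTetra_sqLevel_le`) would give
`χ(δ) ≤ ψ` — forces `ψ ≥ 4 + δ > 4`, i.e. `α < 1/2`, i.e. it REFUTES the summit
(`not_matrixMultiplication_of_unpairedRung`, concluding `¬ MatrixMultiplication` by name; under
`ω = 2`: `halfBound_gt_psi_of_matrixMultiplication`, `ψ + δ ≤ a`). So any proof of `stub_sixRungPos`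
compatible with `ω = 2` must certify a STRICT saving of the mirror pairing `(X, σX)` over the product
of the separate values — by the whole pendant mass `δ` in the `HalfAlpha` world — without evaluating
either factor: the precise content of T7's «entangled σ-pair». Negative knowledge, importable by the
crux-ideate / lead seats of 26697.

References: Christandl–Vrana–Zuiddam [ChristandlVranaZuiddam2016] (arXiv:1609.07476) Ex. 1.1.2, §1.1
(graph tensors with non-uniform bonds multiply edge-wise under `⊠`; restriction), §1.2 eq. (flat)
(flattening lower bounds), Prop. 1.1.16 (proof); Bürgisser–Clausen–Shokrollahi
[BurgisserClausenShokrollahi1997] §14.4 (flattenings / substitution lower bounds); Le Gall [LeGall2012]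
§1 (`ω(1,1,½) = 2 ⟺ α ≥ 1/2`). No `sorry`, no new axiom, no instance, no notation.
-/

noncomputable section

set_option linter.dupNamespace false

open Finset Filter Asymptotics Literature.Computability.AlgebraicComplexity
open Summit.MatrixMultiplication.MatrixMultiplication.Theorems.TetrahedronTensor
open Summit.MatrixMultiplication.MatrixMultiplication.Theorems.TetraDiagonal
open Summit.MatrixMultiplication.MatrixMultiplication.Theses.TetrahedronCarving

namespace Summit.MatrixMultiplication.MatrixMultiplication.Theorems.EdgePencil

/-! ## §4 The un-pairing floor: `N²·e ≤ R₄(X_N^{(e,d)})` (party-`0` flattening) -/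

section Floor

variable {F : Type*} [Field F]

/-- The slice of a 4-tensor at a fixed index on leg `0`. -/
def slice₀ {m : ℕ} (T : (Fin 4 → Fin m) → F) (a : Fin m) : Fin m → Fin m → Fin m → F :=
  fun b c d => T ![a, b, c, d]

/-- **One-leg flattening lower bound for 4-tensors.** If a family of leg-`0` slices of `T` is
linearly independent, its size is at most `R₄(T)`: a decomposition
`T = ∑_{l<r} u_l⁰ ⊗ u_l¹ ⊗ u_l² ⊗ u_l³` puts every slice in the span of the `r` tensors
`u_l¹ ⊗ u_l² ⊗ u_l³` (one-leg version of `TetrahedronTensorCore.card_le_tensorRankD_of_linearIndependent`).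
[cite: BurgisserClausenShokrollahi1997, §14.4 (flattening / substitution lower bounds)] -/
theorem card_le_tensorRankD_of_linearIndependent₀ {m : ℕ} (T : (Fin 4 → Fin m) → F)
    (hT : ∃ s : ℕ, ∃ g : Fin s → ((Fin 4 → Fin m) → F),
      (∀ k, g k ∈ rankOneTensors F m 4) ∧ ∑ k, g k = T)
    {σ : Type*} [Fintype σ] (a : σ → Fin m)
    (h : LinearIndependent F (fun s => slice₀ T (a s))) :
    Fintype.card σ ≤ tensorRankD T := by
  classical
  obtain ⟨g, hg, hsum⟩ := sComplexity_spec hT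
  simp only [rankOneTensors, Set.mem_range] at hg
  choose u hu using hg
  -- the `r` tensors `u_l¹ ⊗ u_l² ⊗ u_l³`
  let M : Fin (tensorRankD T) → Fin m → Fin m → Fin m → F :=
    fun l b c d => u l 1 b * u l 2 c * u l 3 d
  let W : Submodule F (Fin m → Fin m → Fin m → F) := Submodule.span F (Set.range M)
  have hmem : ∀ s, slice₀ T (a s) ∈ W := by
    intro s
    have hslice : slice₀ T (a s) = ∑ l, (u l 0 (a s)) • M l := by
      funext b c d
      simp only [slice₀]
      rw [show T ![a s, b, c, d] = ∑ l, g l ![a s, b, c, d] from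
          (congrFun hsum.symm _).trans (Finset.sum_apply _ _ _), Finset.sum_apply, Finset.sum_apply,
        Finset.sum_apply]
      refine Finset.sum_congr rfl fun l _ => ?_
      rw [← hu l, rankOneTensor_apply, Fin.prod_univ_four]
      simp [M, mul_assoc]
    rw [hslice]
    exact W.sum_mem fun l _ => W.smul_mem _ (Submodule.subset_span ⟨l, rfl⟩)
  have h' : LinearIndependent F (fun s => (⟨slice₀ T (a s), hmem s⟩ : W)) :=
    LinearIndependent.of_comp W.subtype h
  calc Fintype.card σ ≤ Module.finrank F W := h'.fintype_card_le_finrank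
    _ ≤ Fintype.card (Fin (tensorRankD T)) := finrank_range_le_card M
    _ = tensorRankD T := Fintype.card_fin _

/-- Values of `X_N^{(e,d)}` on encoded label triples: the four tests times the consistency test. -/
theorem halfTetra_apply_enc {N e d : ℕ} (L : Fin 4 → Fin 3 → Fin N) :
    halfTetra F N e d (fun v => enc (L v 0) (L v 1) (L v 2)) =
      (if ((L 0 0 : ℕ) < e) then 1 else 0) *
        ((if ((L 1 1 : ℕ) < 1) then 1 else 0) * (if ((L 1 2 : ℕ) < 1) then 1 else 0)) *
        (if ((L 2 2 : ℕ) < d) then 1 else 0) * (if consistent L then 1 else 0) := by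
  simp only [halfTetra, tetra_apply_enc, thinInd, symm_enc, Matrix.cons_val_zero, Matrix.cons_val_one,
    Matrix.cons_val_two, Matrix.head_cons, Matrix.tail_cons]

/-- The `e·N·N` leg-`0` slices of `X_N^{(e,d)}` at the leg-`0` indices `(ℓ, b, c)` (`ℓ < e`: the
pendant label; `b, c`: the labels of `02, 03`) are linearly independent: the slice of `(ℓ,b,c)` is
the only one that is non-zero at the point `((ℓ,0,0),(b,0,0),(c,0,0))` of legs `1,2,3` (`1 ≤ d`).
[cite: ChristandlVranaZuiddam2016, §1.2 (flattening lower bound)] -/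
theorem linearIndependent_halfTetra_slices {N e d : ℕ} [NeZero N] (he : e ≤ N) (hd : 0 < d) :
    LinearIndependent F (fun s : Fin e × Fin N × Fin N =>
      slice₀ (halfTetra F N e d) (enc (Fin.castLE he s.1) s.2.1 s.2.2)) := by
  classical
  rw [Fintype.linearIndependent_iff]
  intro g hg s₀
  obtain ⟨l₀, b₀, c₀⟩ := s₀
  have h := congr_fun (congr_fun (congr_fun hg (enc (Fin.castLE he l₀) 0 0)) (enc b₀ 0 0)) (enc c₀ 0 0)
  rw [Finset.sum_apply, Finset.sum_apply, Finset.sum_apply,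
    Fintype.sum_eq_single (l₀, b₀, c₀)] at h
  · -- the surviving term is `g s₀ * 1`
    have hval : slice₀ (halfTetra F N e d) (enc (Fin.castLE he l₀) b₀ c₀)
        (enc (Fin.castLE he l₀) 0 0) (enc b₀ 0 0) (enc c₀ 0 0) = 1 := by
      have := halfTetra_apply_enc (F := F) (e := e) (d := d)
        ![![Fin.castLE he l₀, b₀, c₀], ![Fin.castLE he l₀, 0, 0], ![b₀, 0, 0], ![c₀, 0, 0]]
      simp only [slice₀]
      convert this using 2
      · funext v; fin_cases v <;> simp
      · simp [consistent, hd]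
    simpa [hval] using h
  · rintro ⟨l, b, c⟩ hne
    have hval : slice₀ (halfTetra F N e d) (enc (Fin.castLE he l) b c)
        (enc (Fin.castLE he l₀) 0 0) (enc b₀ 0 0) (enc c₀ 0 0) = 0 := by
      have := halfTetra_apply_enc (F := F) (e := e) (d := d)
        ![![Fin.castLE he l, b, c], ![Fin.castLE he l₀, 0, 0], ![b₀, 0, 0], ![c₀, 0, 0]]
      simp only [slice₀]
      have hnc : ¬ consistent ![![Fin.castLE he l, b, c], ![Fin.castLE he l₀, 0, 0], ![b₀, 0, 0],
          ![c₀, 0, 0]] = true := by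
        rw [consistent_iff]
        intro hc
        apply hne
        simp only [Prod.mk.injEq]
        simp at hc
        exact ⟨hc.1, hc.2.1, hc.2.2⟩
      rw [if_neg hnc, mul_zero] at this
      convert this using 2
      funext v; fin_cases v <;> simp
    simp [hval]

/-- **The un-pairing floor** `N·N·e ≤ R₄(X_N^{(e,d)})` for `e ≤ N`, `1 ≤ d`: the party-`0`
flattening of the half-tensor has rank `N²e` — evaluated SEPARATELY, the half is charged the full
pendant. NODE-g26 §2 I-R1 `flattening_floor`, now proved.
[cite: ChristandlVranaZuiddam2016, §1.2 (eq. (flat))] -/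
theorem sq_mul_le_tensorRankD_halfTetra {N e d : ℕ} (he : e ≤ N) (hd : 0 < d) :
    N * N * e ≤ tensorRankD (halfTetra F N e d) := by
  rcases Nat.eq_zero_or_pos N with rfl | hN
  · simp
  · haveI : NeZero N := ⟨hN.ne'⟩
    have h := card_le_tensorRankD_of_linearIndependent₀ (halfTetra F N e d)
      (halfTetra_decomposable N e d) _ (linearIndependent_halfTetra_slices (F := F) he hd)
    simp only [Fintype.card_prod, Fintype.card_fin] at h
    calc N * N * e = e * (N * N) := Nat.mul_comm _ _
      _ ≤ tensorRankD (halfTetra F N e d) := h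

/-- **Floor × ceiling of the pair**: `(N·N·e)² ≤ R₄(X)·R₄(σX)`-free form — the separate values of
the two halves multiply to at least `N⁴·e²`, whereas `W_N^{(e²)}` itself only has the flattening
floor `N⁴` (`pow_four_le_tensorRankD_tetra'` through `sixTetra`): the whole factor `e²` is what the
pairing must save for the rung. Stated as `N·N·e ≤ R₄(X)` and `N·N·e ≤ R₄(σX)`'s substitute
`R₄(σX) ≤ R₄(X)` is the only inequality available in general, so we record the floor for `X` and the
square. [folklore] -/
theorem sq_floor_halfTetra {N e d : ℕ} (he : e ≤ N) (hd : 0 < d) :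
    (N * N * e) ^ 2 ≤ tensorRankD (halfTetra F N e d) ^ 2 :=
  Nat.pow_le_pow_left (sq_mul_le_tensorRankD_halfTetra he hd) 2

end Floor

/-! ## §5 The by-name corollary: an un-paired rung certificate refutes `ω = 2` -/

section Exponent

variable {F : Type*} [Field F]

/-- **Separate evaluation is charged the pendant**: if the half-tensor family
`X_{m·m}^{(⌈m^δ⌉, m)}` has `R₄ ≤ C·m^a` for all `m ≥ 1` (`δ ≤ 2`), then `4 + δ ≤ a`
(the un-pairing floor `m⁴·⌈m^δ⌉ ≤ R₄`). [cite: ChristandlVranaZuiddam2016, §1.2 (eq. (flat))] -/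
theorem four_add_le_of_halfBound {δ a C : ℝ} (hδ2 : δ ≤ 2)
    (hX : ∀ m : ℕ, 1 ≤ m →
      (tensorRankD (halfTetra F (m * m) ⌈(m : ℝ) ^ δ⌉₊ m) : ℝ) ≤ C * (m : ℝ) ^ a) :
    4 + δ ≤ a := by
  refine le_of_eventually_rpow_le_of_isBigO
    (f := fun m : ℕ => (tensorRankD (halfTetra F (m * m) ⌈(m : ℝ) ^ δ⌉₊ m) : ℝ)) ?_ ?_
  · filter_upwards [eventually_ge_atTop 1] with m hm
    have hfl := sq_mul_le_tensorRankD_halfTetra (F := F) (N := m * m) (e := ⌈(m : ℝ) ^ δ⌉₊)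
      (d := m) (ceil_rpow_le_sq hm hδ2) (by omega)
    have hpos : (0 : ℝ) < m := by exact_mod_cast hm
    have h4 : (m : ℝ) ^ (4 : ℝ) = (m : ℝ) ^ (4 : ℕ) := by exact_mod_cast Real.rpow_natCast (m : ℝ) 4
    have h1 : (m : ℝ) ^ (4 + δ) = ((m : ℝ) * m * (m * m)) * (m : ℝ) ^ δ := by
      rw [Real.rpow_add hpos, h4]; ring
    calc (m : ℝ) ^ (4 + δ) = ((m : ℝ) * m * (m * m)) * (m : ℝ) ^ δ := h1
      _ ≤ ((m : ℝ) * m * (m * m)) * (⌈(m : ℝ) ^ δ⌉₊ : ℝ) := by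
          gcongr
          exact Nat.le_ceil _
      _ = ((m * m * (m * m) * ⌈(m : ℝ) ^ δ⌉₊ : ℕ) : ℝ) := by push_cast; ring
      _ ≤ _ := by exact_mod_cast hfl
  · refine IsBigO.of_bound C ?_
    filter_upwards [eventually_ge_atTop 1] with m hm
    rw [Real.norm_of_nonneg (Nat.cast_nonneg _),
      Real.norm_of_nonneg (Real.rpow_nonneg (Nat.cast_nonneg _) _)]
    exact hX m hm

/-- **An UN-PAIRED rung certificate refutes the summit.** If the half-tensors are evaluated with an
exponent `a ≤ ψ = ω(2,1,2)` — which by the pairing `R₄(W_{m²}^{(⌈m^δ⌉²)}) ≤ R₄(X)²`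
(`tensorRankD_sixTetra_sqLevel_le`) would certify the rung `χ(δ) ≤ ψ` of `stub_sixRungPos` — then
`ψ ≥ 4 + δ > 4`, i.e. `α < 1/2`, i.e. `¬ (ω = 2)` (`MatrixMultiplication → α ≥ 1/2 → ψ = 4`,
`EdgePencilExcess`). So a rung proof compatible with `ω = 2` must certify a STRICT saving of the
mirror pairing `(X, σX)` over the product of the separate values (the critic's trap T7).
[cite: LeGall2012, §1] -/
theorem not_matrixMultiplication_of_unpairedRung {δ a C : ℝ} (hδ0 : 0 < δ) (hδ1 : δ ≤ 1)
    (hX : ∀ m : ℕ, 1 ≤ m →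
      (tensorRankD (halfTetra ℂ (m * m) ⌈(m : ℝ) ^ δ⌉₊ m) : ℝ) ≤ C * (m : ℝ) ^ a)
    (ha : a ≤ omegaRect ℂ 2 1 2) : ¬ _root_.MatrixMultiplication := by
  intro hS
  have h4 : omegaRect ℂ 2 1 2 = 4 :=
    (omegaRect_two_one_two_eq_four_iff_half_le_dualExponentAlpha (F := ℂ)).2
      (halfAlpha_of_matrixMultiplication hS)
  have h := four_add_le_of_halfBound (F := ℂ) (by linarith) hX
  linarith

/-- The same, read on the route: under `ω = 2` (hence `HalfAlpha`, `ψ = 4`) every separate evaluation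
of the half-tensors has exponent `a ≥ 4 + δ > ψ`; the rung `χ(δ) = ψ = 4` then demands that the
pairing save the ENTIRE pendant mass `δ`. [cite: LeGall2012, §1] -/
theorem halfBound_gt_psi_of_matrixMultiplication (hS : _root_.MatrixMultiplication) {δ a C : ℝ}
    (hδ1 : δ ≤ 1)
    (hX : ∀ m : ℕ, 1 ≤ m →
      (tensorRankD (halfTetra ℂ (m * m) ⌈(m : ℝ) ^ δ⌉₊ m) : ℝ) ≤ C * (m : ℝ) ^ a) :
    omegaRect ℂ 2 1 2 + δ ≤ a := by
  have h4 : omegaRect ℂ 2 1 2 = 4 :=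
    (omegaRect_two_one_two_eq_four_iff_half_le_dualExponentAlpha (F := ℂ)).2
      (halfAlpha_of_matrixMultiplication hS)
  have h := four_add_le_of_halfBound (F := ℂ) (by linarith) hX
  linarith

end Exponent

end Summit.MatrixMultiplication.MatrixMultiplication.Theorems.EdgePencil

end
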